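import Mathlib.NumberTheory.GaussSum
import Mathlib.Analysis.SpecialFunctions.Complex.CircleAddChar
import Literature.NumberTheory.LFunctions.ChebyshevHalfLineBiasCharacters
import Literature.NumberTheory.LFunctions.WeilExplicit
import Literature.NumberTheory.LFunctions.ZetaRealAxis
import HarnessLib

/-!
# RH-CONDITIONAL / GRH-EQUIVALENT criteria (Thms 1–3) — RH-FREE literature; «nothing here bears on the truth of RH»
# Detecting zeros of Dirichlet `L`-functions in the vertical distribution of the zeros of `ζ` (Suzuki 2025, triage-typing)

TRIAGE-TYPING of a 2025 preprint, AS PRINTED, with a status note and NO endorsement (RH literature-typing tranche 1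
part 2, director-rh 2026-08-26, D-0088(4): a 2025 preprint by the author of the tranche's named source Suzuki, Ramanujan J.
68 (2025) = arXiv:2411.07436, with the same device — the Riesz weight `(1 − log n/log x)` on a von Mangoldt sum, (1.9) — and
cited together with it). Source, read in full (held text `paper:arxiv-2508.17701`, 15 pp.):

> M. Suzuki, *Detecting zeros of Dirichlet L-functions via the Riemann zeta-function*, arXiv:2508.17701v1 [math.NT],
> 25 Aug 2025 (v1 is the only version, checked 2026-08-27) [bib: `Suzuki2025Detecting`].

STATUS: PREPRINT, unrefereed. The three printed theorems are NAMED FACTS `def … : Prop` (D-0014); the only things PROVED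
here are bookkeeping consequences of the facts (`Suzuki2025Detecting_thm2.tendsto_norm_atTop`: under the fact, a zero of
`L(s, χ)` at `½ + it` makes the twisted zero sum (1.7) unbounded — the «detection» of the title).

## Dictionary (tree vocabulary; ONE new notion, the paper's sum `Z(x; t, α)`)

* «the nontrivial zeros `ρ = 1/2 + iγ` of `ζ(s)`, counted with multiplicity» (under RH) → the tree's index set
  `weilZeroIndex T = {ρ : ζ(ρ) = 0, 0 ≤ Re ρ ≤ 1, 0 < |Im ρ| ≤ T}` (`WeilExplicit.lean`) with the weights
  `riemannZetaZeroOrder ρ` (`ZetaZeros.lean`), exactly as in `zetaZeroSumTrunc` (`ExplicitFormulaPsi.lean`); `γ = Im ρ`.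
  The typed sum runs over ALL non-trivial zeros with ordinate in the window, which is the printed sum under the paper's
  standing hypothesis RH.
* (1.3) `Z(x; t, α) = Σ_{0 < γ − t ≤ 2παx} (γ − t)^{-1/2} e(((γ − t)/2π) log((γ − t)/(2παe))) (1 − log((γ − t)/(2πα))/log x)`,
  `e(w) = exp(2πiw)` → `Suzuki2025Detecting.Z x t α` (NEW definition); the printed main term
  `−(e^{πi/4} μ(q₁)/(√(2π) φ(q₁))) (1/2 − it)^{-2} x^{1/2 − it}/log x` → `Suzuki2025Detecting.mainTerm q₁ x t` (NEW,
  an abbreviation: `μ = ArithmeticFunction.moebius`, `φ = Nat.totient`, `x^{1/2−it} = (x : ℂ) ^ (1/2 − it)`).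
* «GRH for `L(s, χ)`» (§2: the non-trivial zeros of an imprimitive `χ` are those of the inducing `χ*`) = the tree's
  open-strip `DirichletCharacter.RiemannHypothesis χ` (`GeneralizedRH.lean`; encoding (1) of
  `ChebyshevHalfLineBiasCharacters.lean`: the extra zeros of the missing Euler factors lie on `Re s = 0`);
  «`m(t, χ)`, the order of `L(s, χ)` at `s = 1/2 + it`» = `DirichletDisc.zeroOrder χ (1/2 + it)` (there the orders of
  `L(s, χ)` and `L(s, χ*)` agree); the Gauss sum `τ(χ) = Σ_{a mod q} χ(a) e(a/q)` = Mathlib's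
  `gaussSum χ ZMod.stdAddChar`; `RiemannHypothesis` = Mathlib's; «`t` is not the ordinate of any nontrivial zero» =
  `∀ ρ, ζ(ρ) = 0 → 0 ≤ Re ρ → Re ρ ≤ 1 → Im ρ ≠ t`.
* `O(x^ε)`, `O(1)`, `O(1/log x)`, `o(x^{1/2}/log x)` as `x → ∞` = `=O[atTop]` / `=o[atTop]` on `ℝ`.

## What is here (printed item → declaration → status)

* Thm 1 ((1.4): under RH, GRH for all `χ mod q` ⟺ the asymptotic for `Z(x; t, a/q₁)` with error `O(x^ε)`, all admissible
  `a, q₁ ∣ q`; (1.5): under GRH the secondary term `(e^{πi/4}/(2√(2π)φ(q₁))) Σ_{χ mod q₁} conj τ(χ) χ(a) m(t,χ) log x + O(1)`)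
  → `Suzuki2025Detecting_thm1` — NAMED FACT (RH-CONDITIONAL; GRH-EQUIVALENT criterion).
* Thm 2 ((1.6): GRH for one non-principal `χ` with `τ(χ) ≠ 0` ⟺ `Σ_{a=1}^{q} conj χ(a) Z(x; t, a/q) = O(x^ε)`; (1.7): under
  GRH for `χ` it equals `(e^{πi/4} conj τ(χ)/(2√(2π))) m(t, χ) log x + O(1)`; (1.8): the principal-character average) →
  `Suzuki2025Detecting_thm2` — NAMED FACT (RH-CONDITIONAL); PROVED from it: `Suzuki2025Detecting_thm2.tendsto_norm_atTop`
  (a zero of `L(s, χ)` at `½ + it` is «detected»: the sum (1.7) is unbounded) and `.isBigO_one_of_zeroOrder_eq_zero`.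
* Thm 3 (under RH, Fujii-type dichotomy: `Z(x; t, α) = mainTerm·(1 + o(1))` for rational `α = a/q`, `o(x^{1/2}/log x)` for
  irrational `α`) → `Suzuki2025Detecting_thm3` — NAMED FACT (RH-CONDITIONAL). READING recorded: for rational `α = a/q` the
  printed «`M(x)(1 + o(1))`» is typed as `Z − M = o(x^{1/2}/log x)`, which is what it says when `μ(q) ≠ 0`
  (`|M(x)| ≍ x^{1/2}/log x`) and is the only meaningful reading when `μ(q) = 0` (`M ≡ 0`).
* NOT typed: Props 1–3 (the two evaluations of `Ψ(x; s, α) = Σ_{n ≤ x} Λ(n) e(−αn) n^{-s} (1 − log n/log x)`, (1.9), via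
  Dirichlet `L`-functions and via the explicit formula — steps of the proofs), the Linnik–Sprindžuk theorem (1.1) and
  Fujii's (1.2) (results of other papers, quoted), and the §6 outline (roles of `ζ` and `L(s, χ)` interchanged; no
  numbered statement).

Nothing in this file is, or is worded as, progress toward RH or GRH: every fact ASSUMES RH, and its content is an
equivalence between GRH and an asymptotic for a sum over the zeros of `ζ`.
-/

noncomputable section

open Filter Topology Asymptotics Complex
open scoped Real ComplexConjugate

namespace Literature.NumberTheory.LFunctions

namespace Suzuki2025Detecting

/-- **The zero sum `Z(x; t, α)` of (1.3)**:
`Z(x; t, α) = Σ_{0 < γ − t ≤ 2παx} (γ − t)^{-1/2} e(((γ − t)/2π) log((γ − t)/(2παe))) (1 − log((γ − t)/(2πα))/log x)`,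
the sum over the non-trivial zeros `ρ` of `ζ` with ordinate `γ = Im ρ` in `(t, t + 2παx]`, counted with multiplicity
`riemannZetaZeroOrder ρ` (the paper writes `ρ = 1/2 + iγ` under its standing hypothesis RH; the typed sum is over all
non-trivial zeros in the window, the same thing under RH); `e(w) = exp(2πiw)`, so the phase is
`exp(i (γ − t) log((γ − t)/(2παe)))`. «The mollifier `1 − (log x)^{-1} log((γ−t)/(2πα))` is consistent with the summation
range.» [cite: Suzuki2025Detecting, §1 eq. (1.3)] -/
def Z (x t α : ℝ) : ℂ :=
  ∑ ρ ∈ (weilZeroIndex_finite (|t| + 2 * π * α * x)).toFinset with t < ρ.im ∧ ρ.im ≤ t + 2 * π * α * x,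
    (riemannZetaZeroOrder ρ : ℂ) *
      ((((ρ.im - t) ^ (-(1 / 2 : ℝ)) : ℝ) : ℂ) *
        Complex.exp (I * ((ρ.im - t : ℝ) : ℂ) * (Real.log ((ρ.im - t) / (2 * π * α * Real.exp 1)) : ℂ)) *
        (1 - (Real.log ((ρ.im - t) / (2 * π * α)) : ℂ) / (Real.log x : ℂ)))

/-- The range of summation of `Z(x; t, α)` is exactly «the nontrivial zeros with `0 < γ − t ≤ 2παx`»: for `αx ≥ 0`, a
complex number is in the filtered index set iff it is a zero of `ζ` with `0 ≤ Re ρ ≤ 1` and `t < Im ρ ≤ t + 2παx` (the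
outer truncation height `|t| + 2παx` of `weilZeroIndex` loses nothing, and `ζ` has no zero on the real segment `[0, 1]`:
`riemannZeta_zero`, `riemannZeta_ofReal_ne_zero_of_pos_of_lt_one`, `riemannZeta_ne_zero_of_one_le_re`).
[cite: Suzuki2025Detecting, §1 eq. (1.3)] -/
theorem mem_filter_weilZeroIndex_iff {x t α : ℝ} (hαx : 0 ≤ α * x) {ρ : ℂ} :
    ρ ∈ ((weilZeroIndex_finite (|t| + 2 * π * α * x)).toFinset.filter
        fun ρ => t < ρ.im ∧ ρ.im ≤ t + 2 * π * α * x) ↔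
      riemannZeta ρ = 0 ∧ 0 ≤ ρ.re ∧ ρ.re ≤ 1 ∧ t < ρ.im ∧ ρ.im ≤ t + 2 * π * α * x := by
  simp only [Finset.mem_filter, Set.Finite.mem_toFinset, weilZeroIndex, Set.mem_setOf_eq]
  constructor
  · rintro ⟨⟨hz, h0, h1, -, -⟩, ht1, ht2⟩
    exact ⟨hz, h0, h1, ht1, ht2⟩
  · rintro ⟨hz, h0, h1, ht1, ht2⟩
    have h2 : 0 ≤ 2 * π * α * x := by
      have : 2 * π * α * x = 2 * π * (α * x) := by ring
      rw [this]; positivity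
    refine ⟨⟨hz, h0, h1, ?_, ?_⟩, ht1, ht2⟩
    · -- `Im ρ ≠ 0`: there is no zero of `ζ` on the real segment `[0, 1]`
      intro him
      have hreal : ρ = (ρ.re : ℂ) := Complex.ext (by simp) (by simp [him])
      rw [hreal] at hz
      rcases h0.eq_or_lt with h00 | h0'
      · rw [← h00] at hz
        norm_num [riemannZeta_zero] at hz
      rcases h1.lt_or_eq with h1' | h11
      · exact riemannZeta_ofReal_ne_zero_of_pos_of_lt_one ρ.re h0' h1' hz
      · exact riemannZeta_ne_zero_of_one_le_re (s := (ρ.re : ℂ)) (by simp [h11]) hz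
    · rw [abs_le]
      constructor
      · linarith [neg_abs_le t]
      · linarith [le_abs_self t]

/-- **The main term** `−(e^{πi/4} μ(q₁)/(√(2π) φ(q₁))) · (1/2 − it)^{-2} · x^{1/2 − it}/log x` of (1.4), (1.5) and Thm 3.
[cite: Suzuki2025Detecting, Thm 1 eq. (1.4)] -/
def mainTerm (q₁ : ℕ) (x t : ℝ) : ℂ :=
  -(Complex.exp (π * I / 4) * (ArithmeticFunction.moebius q₁ : ℂ) /
      ((Real.sqrt (2 * π) : ℂ) * (Nat.totient q₁ : ℂ))) *
    (1 / ((1 / 2 : ℂ) - t * I) ^ 2) * ((x : ℂ) ^ ((1 / 2 : ℂ) - t * I) / (Real.log x : ℂ))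

/-- «`t` is not the ordinate of any nontrivial zero of `ζ(s)`» (standing hypothesis of Thms 1–2).
[cite: Suzuki2025Detecting, Thm 1] -/
def NotOrdinate (t : ℝ) : Prop :=
  ∀ ρ : ℂ, riemannZeta ρ = 0 → 0 ≤ ρ.re → ρ.re ≤ 1 → ρ.im ≠ t

end Suzuki2025Detecting

open Suzuki2025Detecting

/-! ## The main theorems — NAMED FACTS (RH-CONDITIONAL) -/

/-- NAMED FACT — **Thm 1**, AS PRINTED: «Assume RH. Let `t` be a real number that is not the ordinate of any nontrivial
zero of `ζ(s)`, and let `q ≥ 3` be a positive integer. Let `m(t, χ)` denote the order of the Dirichlet `L`-function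
`L(s, χ)` at the point `s = 1/2 + it`. Then the GRH for all Dirichlet `L`-functions `L(s, χ)` associated with Dirichlet
characters `χ mod q` is equivalent to the asymptotic formula
`Z(x; t, a/q₁) = −(e^{πi/4} μ(q₁)/(√(2π) φ(q₁))) · (1/2 − it)^{-2} · x^{1/2 − it}/log x + O(x^ε)` (1.4) as `x → ∞`, for
any `ε > 0` and for any integer `a` with `1 ≤ a < q₁`, `(a, q₁) = 1`, and `q₁ ∣ q`, where the implied constant may depend
on `t`, `q₁`, and `ε`. Moreover, assuming the GRH for all `L(s, χ)` with `χ mod q`, we obtain the formula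
`Z(x; t, a/q₁) = −(…) x^{1/2 − it}/log x + (e^{πi/4}/(2√(2π) φ(q₁))) Σ_{χ mod q₁} conj τ(χ) χ(a) m(t, χ) log x + O(1)`
(1.5) as `x → ∞`, for any integer `a` with `1 ≤ a < q₁`, `(a, q₁) = 1`, and `q₁ ∣ q`.» («GRH for all `χ mod q`» includes
the principal character, whose GRH is RH — assumed; cf. the printed Prop 1 «including the principal character».)
RH-CONDITIONAL; GRH-EQUIVALENT criterion. Users take `(h : Suzuki2025Detecting_thm1)`.
[cite: Suzuki2025Detecting, Thm 1 (eqs. (1.4)–(1.5))] -/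
def Suzuki2025Detecting_thm1 : Prop :=
  RiemannHypothesis → ∀ t : ℝ, NotOrdinate t → ∀ (q : ℕ) [NeZero q], 3 ≤ q →
    ((∀ χ : DirichletCharacter ℂ q, χ.RiemannHypothesis) ↔
      ∀ ε : ℝ, 0 < ε → ∀ q₁ a : ℕ, q₁ ∣ q → 1 ≤ a → a < q₁ → a.Coprime q₁ →
        (fun x : ℝ => Z x t (a / q₁) - mainTerm q₁ x t) =O[atTop] fun x : ℝ => x ^ ε) ∧
    ((∀ χ : DirichletCharacter ℂ q, χ.RiemannHypothesis) →
      ∀ (q₁ : ℕ) [NeZero q₁] (a : ℕ), q₁ ∣ q → 1 ≤ a → a < q₁ → a.Coprime q₁ →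
        (fun x : ℝ => Z x t (a / q₁) - mainTerm q₁ x t -
          Complex.exp (π * I / 4) / (2 * (Real.sqrt (2 * π) : ℂ) * (Nat.totient q₁ : ℂ)) *
            (∑ χ : DirichletCharacter ℂ q₁, conj (gaussSum χ ZMod.stdAddChar) * χ (a : ZMod q₁) *
              (DirichletDisc.zeroOrder χ (1 / 2 + t * I) : ℂ)) * (Real.log x : ℂ)) =O[atTop]
          fun _ : ℝ => (1 : ℝ))

/-- NAMED FACT — **Thm 2**, AS PRINTED: «Assume RH, and let `t` be a real number that is not the ordinate of any nontrivial
zero of `ζ(s)`. Let `χ` be a non-principal Dirichlet character modulo `q (≥ 3)` such that `τ(χ) ≠ 0`, and let `m(t, χ)`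
denote the order of the Dirichlet `L`-function `L(s, χ)` at `s = 1/2 + it`. Then the GRH for `L(s, χ)` is equivalent to
the bound `Σ_{a=1}^{q} conj χ(a) Z(x; t, a/q) = O(x^ε)` (1.6) as `x → ∞`, for any `ε > 0` … Moreover, assuming the GRH for
`L(s, χ)`, we have `Σ_{a=1}^{q} conj χ(a) Z(x; t, a/q) = (e^{πi/4} conj τ(χ)/(2√(2π))) m(t, χ) log x + O(1)` (1.7) as
`x → ∞` … On the other hand, for the principal character `χ₀ mod q`,
`Σ_{a=1}^{q} χ₀(a) Z(x; t, a/q) = −(e^{πi/4} μ(q)/√(2π)) · (1/2 − it)^{-2} · x^{1/2 − it}/log x + A₀(t, a/q) + O(1/log x)`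
(1.8) as `x → ∞` for some constant `A₀(t, a/q)`.» `τ(χ) = gaussSum χ ZMod.stdAddChar`; `χ₀(a) = (1 : DirichletCharacter ℂ q) a`
(`1` on units, `0` otherwise); the main term of (1.8) is `φ(q) · mainTerm q x t`. RH-CONDITIONAL; (1.6) is a
GRH(χ)-EQUIVALENT criterion. Users take `(h : Suzuki2025Detecting_thm2)`.
[cite: Suzuki2025Detecting, Thm 2 (eqs. (1.6)–(1.8))] -/
def Suzuki2025Detecting_thm2 : Prop :=
  RiemannHypothesis → ∀ t : ℝ, NotOrdinate t → ∀ (q : ℕ) [NeZero q], 3 ≤ q →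
    (∀ χ : DirichletCharacter ℂ q, χ ≠ 1 → gaussSum χ ZMod.stdAddChar ≠ 0 →
      (χ.RiemannHypothesis ↔ ∀ ε : ℝ, 0 < ε →
        (fun x : ℝ => ∑ a ∈ Finset.Icc 1 q, conj (χ (a : ZMod q)) * Z x t (a / q)) =O[atTop]
          fun x : ℝ => x ^ ε) ∧
      (χ.RiemannHypothesis →
        (fun x : ℝ => ∑ a ∈ Finset.Icc 1 q, conj (χ (a : ZMod q)) * Z x t (a / q) -
            Complex.exp (π * I / 4) * conj (gaussSum χ ZMod.stdAddChar) / (2 * (Real.sqrt (2 * π) : ℂ)) *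
              (DirichletDisc.zeroOrder χ (1 / 2 + t * I) : ℂ) * (Real.log x : ℂ)) =O[atTop]
          fun _ : ℝ => (1 : ℝ))) ∧
    (∃ A₀ : ℂ,
      (fun x : ℝ => ∑ a ∈ Finset.Icc 1 q, (1 : DirichletCharacter ℂ q) (a : ZMod q) * Z x t (a / q) -
          (Nat.totient q : ℂ) * mainTerm q x t - A₀) =O[atTop] fun x : ℝ => 1 / Real.log x)

/-- NAMED FACT — **Thm 3**, AS PRINTED: «Assume RH. Then, for any `t ∈ ℝ`,
`Z(x; t, α) = −(e^{πi/4} μ(q)/(√(2π) φ(q))) · (1/2 − it)^{-2} · (x^{1/2 − it}/log x) (1 + o(1))` if `α = a/q` with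
integers `a` and `q ≥ 1`, `(a, q) = 1`, and `Z(x; t, α) = o(x^{1/2}/log x)` otherwise, as `x → ∞`, where the implied
constant may depend on `t` and `α`» (`α > 0` throughout the paper, (1.9)). The rational case is typed as
`Z(x; t, a/q) − mainTerm q x t = o(x^{1/2}/log x)` — the printed `M(x)(1 + o(1))` when `μ(q) ≠ 0` (then
`|M(x)| ≍ x^{1/2}/log x`), and its only meaningful reading when `μ(q) = 0` (recorded reading). RH-CONDITIONAL.
Users take `(h : Suzuki2025Detecting_thm3)`. [cite: Suzuki2025Detecting, Thm 3] -/
def Suzuki2025Detecting_thm3 : Prop :=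
  RiemannHypothesis → ∀ t α : ℝ, 0 < α →
    (∀ a q : ℕ, 1 ≤ q → a.Coprime q → α = a / q →
      (fun x : ℝ => Z x t α - mainTerm q x t) =o[atTop] fun x : ℝ => x ^ (1 / 2 : ℝ) / Real.log x) ∧
    (Irrational α → (fun x : ℝ => Z x t α) =o[atTop] fun x : ℝ => x ^ (1 / 2 : ℝ) / Real.log x)

/-! ## «Detecting» a zero of `L(s, χ)` — PROVED from Thm 2 -/

namespace Suzuki2025Detecting_thm2

/-- **The detection, proved from Thm 2**: under RH and GRH for a non-principal `χ mod q` (`q ≥ 3`) with `τ(χ) ≠ 0`, if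
`L(s, χ)` vanishes at `½ + it` (`m(t, χ) ≥ 1`; `t` not an ordinate of a zero of `ζ`), then the twisted zero sum of (1.7)
is unbounded: `‖Σ_{a=1}^{q} conj χ(a) Z(x; t, a/q)‖ → ∞` — «the graph exhibits peaks at the ordinates of the nontrivial
zeros of `L(s, χ)`, as expected from (1.7)». [cite: Suzuki2025Detecting, Thm 2 (eq. (1.7)) and the discussion of Figure 1] -/
theorem tendsto_norm_atTop (h : Suzuki2025Detecting_thm2) (hRH : RiemannHypothesis) {t : ℝ} (ht : NotOrdinate t)
    {q : ℕ} [NeZero q] (hq : 3 ≤ q) {χ : DirichletCharacter ℂ q} (hχ : χ ≠ 1)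
    (hτ : gaussSum χ ZMod.stdAddChar ≠ 0) (hGRH : χ.RiemannHypothesis)
    (hm : 1 ≤ DirichletDisc.zeroOrder χ (1 / 2 + t * I)) :
    Tendsto (fun x : ℝ => ‖∑ a ∈ Finset.Icc 1 q, conj (χ (a : ZMod q)) * Z x t (a / q)‖) atTop atTop := by
  obtain ⟨hmain, -⟩ := h hRH t ht q hq
  have h17 := (hmain χ hχ hτ).2 hGRH
  obtain ⟨K, hK⟩ := h17.bound
  set c : ℂ := Complex.exp (π * I / 4) * conj (gaussSum χ ZMod.stdAddChar) / (2 * (Real.sqrt (2 * π) : ℂ)) *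
    (DirichletDisc.zeroOrder χ (1 / 2 + t * I) : ℂ) with hc
  have hc0 : 0 < ‖c‖ := by
    rw [hc]
    have h1 : Complex.exp (π * I / 4) ≠ 0 := Complex.exp_ne_zero _
    have h2 : conj (gaussSum χ ZMod.stdAddChar) ≠ 0 := by
      rwa [Ne, map_eq_zero_iff _ (RingHom.injective _)]
    have h3 : (2 * (Real.sqrt (2 * π) : ℂ)) ≠ 0 := by
      have : (0 : ℝ) < Real.sqrt (2 * π) := Real.sqrt_pos.2 (by positivity)
      exact mul_ne_zero two_ne_zero (by exact_mod_cast this.ne')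
    have h4 : (DirichletDisc.zeroOrder χ (1 / 2 + t * I) : ℂ) ≠ 0 := by
      exact_mod_cast (by omega : DirichletDisc.zeroOrder χ (1 / 2 + t * I) ≠ 0)
    exact norm_pos_iff.2 (mul_ne_zero (div_ne_zero (mul_ne_zero h1 h2) h3) h4)
  -- `‖F x‖ ≥ ‖c‖ log x − K` eventually
  have hlow : ∀ᶠ x : ℝ in atTop, ‖c‖ * Real.log x - K ≤
      ‖∑ a ∈ Finset.Icc 1 q, conj (χ (a : ZMod q)) * Z x t (a / q)‖ := by
    filter_upwards [hK, eventually_ge_atTop (1 : ℝ)] with x hx hx1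
    have hlog : 0 ≤ Real.log x := Real.log_nonneg hx1
    have hn : ‖c * (Real.log x : ℂ)‖ = ‖c‖ * Real.log x := by
      rw [norm_mul, Complex.norm_real, Real.norm_eq_abs, abs_of_nonneg hlog]
    simp only [norm_one, mul_one] at hx
    have := norm_sub_norm_le (c * (Real.log x : ℂ)) (∑ a ∈ Finset.Icc 1 q, conj (χ (a : ZMod q)) * Z x t (a / q))
    rw [hn] at this
    have hx' : ‖c * (Real.log x : ℂ) - ∑ a ∈ Finset.Icc 1 q, conj (χ (a : ZMod q)) * Z x t (a / q)‖ ≤ K := by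
      rw [← norm_neg, neg_sub, hc]; exact hx
    linarith
  refine tendsto_atTop_mono' atTop hlow ?_
  have h1 : Tendsto (fun x : ℝ => ‖c‖ * Real.log x) atTop atTop := Real.tendsto_log_atTop.const_mul_atTop hc0
  exact tendsto_atTop_add_const_right atTop (-K) h1 |>.congr fun x => by ring

/-- Conversely (from Thm 2 as well): if `L(½ + it, χ) ≠ 0` (`m(t, χ) = 0`) the twisted zero sum is `O(1)`.
[cite: Suzuki2025Detecting, Thm 2 (eq. (1.7))] -/
theorem isBigO_one_of_zeroOrder_eq_zero (h : Suzuki2025Detecting_thm2) (hRH : RiemannHypothesis) {t : ℝ}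
    (ht : NotOrdinate t) {q : ℕ} [NeZero q] (hq : 3 ≤ q) {χ : DirichletCharacter ℂ q} (hχ : χ ≠ 1)
    (hτ : gaussSum χ ZMod.stdAddChar ≠ 0) (hGRH : χ.RiemannHypothesis)
    (hm : DirichletDisc.zeroOrder χ (1 / 2 + t * I) = 0) :
    (fun x : ℝ => ∑ a ∈ Finset.Icc 1 q, conj (χ (a : ZMod q)) * Z x t (a / q)) =O[atTop]
      fun _ : ℝ => (1 : ℝ) := by
  obtain ⟨hmain, -⟩ := h hRH t ht q hq
  have h17 := (hmain χ hχ hτ).2 hGRH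
  simp only [hm, Nat.cast_zero, mul_zero, zero_mul, sub_zero] at h17
  exact h17

end Suzuki2025Detecting_thm2

end Literature.NumberTheory.LFunctions

end
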